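import Summits.ValiantsHypothesis.ValiantsHypothesis.Theorems.RigidityForcesSymmetryGrenetFirstOrderRankRigidWeights

/-!
# Route RigidityForcesSymmetry — `GrenetFirstOrderRankRigid` (item stmt-ValiantsHypothesis-21029),
line `grenet_gauge`: stub `stub_linearRigid`, step 5 (block W0, part 1) — the indicator torus weights
and the weight-zero block

For the crux line `Cruxes/GrenetFirstOrderRankRigid/Lines/grenet_gauge.lean` (blueprint
`Lines/grenet_gauge-stub_linearRigid-PROOF.md`, §4–§5).  The weight splitting
`grenet_tangency_weightSplit` holds for every additive torus weight `w (j, c) = a j + b c`; the blocks of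
the blueprint are obtained with the INDICATOR weights `a j = δ_(inl j)`, `b c = δ_(inr c)` (values in
`Fin n ⊕ Fin n → ℕ`), for which the entry weight of `(S, T, (p, q))` is the function
`inl j' ↦ [j' ∈ S] + [j' ∉ T] + [j' = p]`, `inr c' ↦ [c' < |S|] + [|T| ≤ c'] + [c' = q]`
(`weightE_apply_inl`, `weightE_apply_inr`) — the blueprint's `(α + 𝟙, β + 𝟙)`.  In particular the
entry weight is the constant `1` (weight ZERO block, `α = β = 0`) exactly at the ARC ENTRIES
`(S, S + p, (p, |S|))`, `p ∉ S` (`weightE_eq_one_iff`).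

No new definitions.  VP ≠ VNP is not moved by this file (first-order bookkeeping about one matrix
family).
-/

noncomputable section

open MvPolynomial Matrix Finset

namespace Summit.ValiantsHypothesis.Theorems.RigidityForcesSymmetry.GrenetGauge

open Literature.Computability.AlgebraicComplexity

/-! ### The weight-zero block: the indicator weights and the arc entries -/

section WeightZero

variable {n : ℕ}

/-- Values of the indicator weights `a j = δ_(inl j)`, `b c = δ_(inr c)` on the row side: the entry
weight of `(S, T, (p, q))` at `inl j'` is `[j' ∈ S] + [j' ∉ T] + [j' = p]`. [folklore] -/
theorem weightE_apply_inl (S T : Finset (Fin n)) (v : Fin n × Fin n) (j' : Fin n) :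
    ((∑ j ∈ S, (Pi.single (Sum.inl j) 1 : Fin n ⊕ Fin n → ℕ) + ∑ j ∈ Tᶜ, (Pi.single (Sum.inl j) 1 : Fin n ⊕ Fin n → ℕ)) +
        (∑ c ∈ univ.filter (fun c : Fin n => (c : ℕ) < S.card), (Pi.single (Sum.inr c) 1 : Fin n ⊕ Fin n → ℕ)
          + ∑ c ∈ univ.filter (fun c : Fin n => T.card ≤ (c : ℕ)), (Pi.single (Sum.inr c) 1 : Fin n ⊕ Fin n → ℕ))
        + ((Pi.single (Sum.inl v.1) 1 : Fin n ⊕ Fin n → ℕ) + (Pi.single (Sum.inr v.2) 1 : Fin n ⊕ Fin n → ℕ)))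
      (Sum.inl j')
      = (if j' ∈ S then 1 else 0) + (if j' ∈ T then 0 else 1) + (if j' = v.1 then 1 else 0) := by
  simp only [Pi.add_apply, Finset.sum_apply, Pi.single_apply, Sum.inl.injEq, reduceCtorEq, if_false,
    Finset.sum_const_zero, add_zero, Finset.sum_ite_eq, Finset.mem_compl]
  by_cases h1 : j' ∈ S <;> by_cases h2 : j' ∈ T <;> simp [h1, h2]

/-- Values of the indicator weights on the column side: the entry weight of `(S, T, (p, q))` at
`inr c'` is `[c' < |S|] + [|T| ≤ c'] + [c' = q]`. [folklore] -/
theorem weightE_apply_inr (S T : Finset (Fin n)) (v : Fin n × Fin n) (c' : Fin n) :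
    ((∑ j ∈ S, (Pi.single (Sum.inl j) 1 : Fin n ⊕ Fin n → ℕ) + ∑ j ∈ Tᶜ, (Pi.single (Sum.inl j) 1 : Fin n ⊕ Fin n → ℕ)) +
        (∑ c ∈ univ.filter (fun c : Fin n => (c : ℕ) < S.card), (Pi.single (Sum.inr c) 1 : Fin n ⊕ Fin n → ℕ)
          + ∑ c ∈ univ.filter (fun c : Fin n => T.card ≤ (c : ℕ)), (Pi.single (Sum.inr c) 1 : Fin n ⊕ Fin n → ℕ))
        + ((Pi.single (Sum.inl v.1) 1 : Fin n ⊕ Fin n → ℕ) + (Pi.single (Sum.inr v.2) 1 : Fin n ⊕ Fin n → ℕ)))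
      (Sum.inr c')
      = (if (c' : ℕ) < S.card then 1 else 0) + (if T.card ≤ (c' : ℕ) then 1 else 0) + (if c' = v.2 then 1 else 0) := by
  simp only [Pi.add_apply, Finset.sum_apply, Pi.single_apply, Sum.inr.injEq, reduceCtorEq, if_false,
    Finset.sum_const_zero, zero_add, Finset.sum_ite_eq, Finset.mem_filter, Finset.mem_univ, true_and]

/-- **The weight-zero block consists of the arc entries.** With the indicator weights, the entry
weight of `(S, T, (p, q))` is the constant `1` iff `p ∉ S`, `T = S + p` and `q = |S|` (the entry of the
arc `S → S + p` in the coefficient matrix of its own variable `x_{p,|S|}`). [folklore] -/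
theorem weightE_eq_one_iff (S T : Finset (Fin n)) (v : Fin n × Fin n) :
    ((∑ j ∈ S, (Pi.single (Sum.inl j) 1 : Fin n ⊕ Fin n → ℕ) + ∑ j ∈ Tᶜ, (Pi.single (Sum.inl j) 1 : Fin n ⊕ Fin n → ℕ)) +
        (∑ c ∈ univ.filter (fun c : Fin n => (c : ℕ) < S.card), (Pi.single (Sum.inr c) 1 : Fin n ⊕ Fin n → ℕ)
          + ∑ c ∈ univ.filter (fun c : Fin n => T.card ≤ (c : ℕ)), (Pi.single (Sum.inr c) 1 : Fin n ⊕ Fin n → ℕ))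
        + ((Pi.single (Sum.inl v.1) 1 : Fin n ⊕ Fin n → ℕ) + (Pi.single (Sum.inr v.2) 1 : Fin n ⊕ Fin n → ℕ)))
      = (fun _ => 1) ↔ (v.1 ∉ S ∧ T = insert v.1 S ∧ (v.2 : ℕ) = S.card) := by
  constructor
  · intro h
    have hl : ∀ j', (if j' ∈ S then 1 else 0) + (if j' ∈ T then 0 else 1) + (if j' = v.1 then 1 else 0) = (1 : ℕ) :=
      fun j' => by rw [← weightE_apply_inl S T v j', h]
    have hr : ∀ c' : Fin n, (if (c' : ℕ) < S.card then 1 else 0) + (if T.card ≤ (c' : ℕ) then 1 else 0)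
        + (if c' = v.2 then 1 else 0) = (1 : ℕ) :=
      fun c' => by rw [← weightE_apply_inr S T v c', h]
    have hp := hl v.1
    rw [if_pos rfl] at hp
    have hpS : v.1 ∉ S := fun h' => by rw [if_pos h'] at hp; omega
    have hpT : v.1 ∈ T := by
      by_contra h'
      rw [if_neg h'] at hp; omega
    have hT : T = insert v.1 S := by
      ext j'
      rw [Finset.mem_insert]
      by_cases hj : j' = v.1
      · subst hj
        exact ⟨fun _ => Or.inl rfl, fun _ => hpT⟩
      · have h' := hl j'
        rw [if_neg hj] at h'
        constructor
        · intro hjT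
          rw [if_pos hjT] at h'
          by_cases hjS : j' ∈ S
          · exact Or.inr hjS
          · rw [if_neg hjS] at h'; omega
        · rintro (h'' | hjS)
          · exact absurd h'' hj
          · rw [if_pos hjS] at h'
            by_contra hjT
            rw [if_neg hjT] at h'; omega
    refine ⟨hpS, hT, ?_⟩
    have hq := hr v.2
    rw [if_pos rfl, hT, Finset.card_insert_of_notMem hpS] at hq
    by_cases h1 : (v.2 : ℕ) < S.card
    · rw [if_pos h1] at hq; omega
    · by_cases h2 : S.card + 1 ≤ (v.2 : ℕ)
      · rw [if_pos h2] at hq; omega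
      · omega
  · rintro ⟨hpS, rfl, hq⟩
    funext x
    cases x with
    | inl j' =>
      rw [weightE_apply_inl]
      by_cases hj : j' = v.1
      · subst hj
        rw [if_neg hpS, if_pos (Finset.mem_insert_self _ _), if_pos rfl]
      · rw [if_neg hj]
        by_cases hjS : j' ∈ S
        · rw [if_pos hjS, if_pos (Finset.mem_insert_of_mem hjS)]
        · rw [if_neg hjS, if_neg (fun h => hjS ((Finset.mem_insert.mp h).resolve_left hj))]
    | inr c' =>
      rw [weightE_apply_inr, Finset.card_insert_of_notMem hpS]
      by_cases hc : c' = v.2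
      · subst hc
        rw [if_pos rfl, if_neg (by omega), if_neg (by omega)]
      · rw [if_neg hc]
        have hc' : (c' : ℕ) ≠ (v.2 : ℕ) := fun h => hc (Fin.ext h)
        by_cases h1 : (c' : ℕ) < S.card
        · rw [if_pos h1, if_neg (by omega)]
        · rw [if_neg h1, if_pos (by omega)]

end WeightZero

end Summit.ValiantsHypothesis.Theorems.RigidityForcesSymmetry.GrenetGauge
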